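import Literature.NumberTheory.EllipticCurves.IwasawaSelmerCoinvariantGrowthProofs
import Literature.NumberTheory.EllipticCurves.IwasawaSelmerModuleFiniteProofs
import Literature.NumberTheory.EllipticCurves.IwasawaSelmerDualProofs
import HarnessLib

/-!
# `{s ∈ Sel_{p^∞}(E/K_∞) : p^k s = 0, conj_{γ^{pⁿ}} s = s}` is FINITE for every layer exponent `n` (and every `k`)
# (the honest cardinality behind the research stub K2_res and the input `hfin`/`hSfin` of the port stub `stub_residualLinkMult`,
# line `beta-road` v5 on crux `TwinAlgMuZeroAtThree`, stmt-BirchSwinnertonDyer-24737)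

Width prover `bsd-wall-utd-p1-w2` g9 under lead `bsd-wall-utd-p1` g23 (`--supports stmt-BirchSwinnertonDyer-24737`, helper).
THEOREMS ONLY (no definition, no named fact, no `sorry`). BSD is not proved by any of this.

For an elliptic curve `E = W/K` over a number field, a prime `p`, a `ℤ_p`-extension `κ` with topological generator `γ`, and all
`n k : ℕ`: the set `Sel_∞[ω_n, p^k] = {s ∈ Sel_{p^∞}(E/K_∞) : p^k s = 0, conj_{γ^{pⁿ}} s = s}` is finite — `X(E/K_∞)` is finitely
generated over `Λ` (tree `SelmerDualData.module_finite_holds`, Greenberg §1 p. 60), `ω_n = (T+1)^{pⁿ} − 1` is monic, and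
`Sel_∞[g, p^k]` is finite of order `≤ p^{k·d·deg g}` for monic `g` and `d` generators (tree `SelmerDualData.finite_smulTorsion_and_natCard_le`,
the dual of «`X/(g, p^k)` is a quotient of `(Λ/(g,p^k))^d`»), with `Sel_∞[ω_n, p^k] = {conj_{γ^{pⁿ}} s = s, p^k s = 0}`
(`setOf_smulFun_omega_selmerInfty_eq`). The tree had the case `n = 0`, `k = 1` (`finite_setOf_selmerInfty_pTorsion_conjH1_eq_of_isTopGenerator`).

* `finite_setOf_selmerInfty_pow_torsion_conjH1_pow_eq` — finiteness for all `n`, `k`, and the bound `≤ p^{k·d·pⁿ}` for any generating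
  family of `X` of size `d`;
* `finite_setOf_selmerInfty_pTorsion_conjH1_pow_eq` — the `k = 1` shape `{s | p • s = 0 ∧ conj_{γ^{pⁿ}} s = s}` VERBATIM as in the
  stubs K2_res / P_res of the line and in the lead's `…SelmerTorsionOverComap.natCard_selmerTorsionOver_layer_le` (hypothesis `hfin`).

References: [GreenbergLNM1716] §1 p. 60 (after Conj. 1.3), Thm. 1.7 and p. 62; [Washington1997] §13.2–13.3; [MazurInvent1972] §6.
-/

set_option linter.dupNamespace false
set_option autoImplicit false

noncomputable section
open scoped Classical

namespace Summit.BirchSwinnertonDyer.BirchSwinnertonDyer.Theorems.UniversalToricDescentSelmerInftyLayerTorsionFinite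

open Literature.NumberTheory.EllipticCurves NumberField IsDedekindDomain WeierstrassCurve Polynomial
  Literature.NumberTheory.EllipticCurves.IwasawaAlgebra

universe u

variable {K : Type u} [Field K] [NumberField K] (W : WeierstrassCurve K) [W.IsElliptic] {p : ℕ} [Fact p.Prime]
  (κ : ZpExtension K p) {γ : Field.absoluteGaloisGroup K} (hγ : κ.IsTopGenerator γ)

omit [W.IsElliptic] in
include hγ in
/-- **`{s ∈ Sel_{p^∞}(E/K_∞) : conj_{γ^{pⁿ}} s = s, p^k s = 0}` is finite, of order `≤ p^{k·d·pⁿ}`** for any family of `d` generators of the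
Iwasawa module `X(E/K_∞)` (which is finitely generated, so such a family exists: `finite_setOf_selmerInfty_pow_torsion_conjH1_pow_eq`).
[cite: GreenbergLNM1716, §1 p. 60 (after Conj. 1.3) and p. 62] [cite: Washington1997, §13.2] -/
theorem finite_setOf_selmerInfty_pow_torsion_conjH1_pow_eq_of_span {d : ℕ} (x : Fin d → (W.selmerDualData κ hγ).X)
    (hx : Submodule.span (IwasawaAlgebra p) (Set.range x) = ⊤) (n k : ℕ) :
    {s : W.selmerInfty κ | W.conjH1 p κ.kerSubgroup (γ ^ p ^ n) (s : W.subgroupH1 p κ.kerSubgroup) = s ∧ p ^ k • s = 0}.Finite ∧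
      Nat.card {s : W.selmerInfty κ |
          W.conjH1 p κ.kerSubgroup (γ ^ p ^ n) (s : W.subgroupH1 p κ.kerSubgroup) = s ∧ p ^ k • s = 0} ≤
        p ^ (k * (d * p ^ n)) := by
  -- `ω_n` is monic of degree `pⁿ`
  set ω : ℤ_[p][X] := (Polynomial.X + 1) ^ p ^ n - 1 with hω
  have hX1 : (Polynomial.X + 1 : ℤ_[p][X]).Monic := by rw [← Polynomial.C_1]; exact Polynomial.monic_X_add_C 1
  have hX1deg : (Polynomial.X + 1 : ℤ_[p][X]).natDegree = 1 := by rw [← Polynomial.C_1]; exact Polynomial.natDegree_X_add_C 1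
  have hlt : Polynomial.degree (1 : ℤ_[p][X]) < Polynomial.degree ((Polynomial.X + 1 : ℤ_[p][X]) ^ p ^ n) := by
    refine Polynomial.degree_lt_degree ?_
    rw [Polynomial.natDegree_one, hX1.natDegree_pow, hX1deg, mul_one]
    exact pow_pos (Nat.Prime.pos Fact.out) n
  have hωm : ω.Monic := (hX1.pow (p ^ n)).sub_of_left hlt
  have hωdeg : ω.natDegree = p ^ n := by
    have hlt' : Polynomial.natDegree (1 : ℤ_[p][X]) < Polynomial.natDegree ((Polynomial.X + 1 : ℤ_[p][X]) ^ p ^ n) := by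
      rw [Polynomial.natDegree_one, hX1.natDegree_pow, hX1deg, mul_one]
      exact pow_pos (Nat.Prime.pos Fact.out) n
    rw [hω, Polynomial.natDegree_sub_eq_left_of_natDegree_lt hlt', hX1.natDegree_pow, hX1deg, mul_one]
  obtain ⟨hfin, hcard⟩ := (W.selmerDualData κ hγ).finite_smulTorsion_and_natCard_le x hx hωm k
  rw [W.setOf_smulFun_omega_selmerInfty_eq κ γ (p ^ n) k, hωdeg] at *
  exact ⟨hfin, hcard⟩

include hγ in
/-- **`{s ∈ Sel_{p^∞}(E/K_∞) : conj_{γ^{pⁿ}} s = s, p^k s = 0}` is finite for all `n`, `k`** (any elliptic curve over a number field, any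
prime, any `ℤ_p`-extension): `X(E/K_∞)` is finitely generated over `Λ` (`SelmerDualData.module_finite_holds`).
[cite: GreenbergLNM1716, §1 p. 60 (after Conj. 1.3)] [cite: Washington1997, §13.2–13.3] -/
theorem finite_setOf_selmerInfty_pow_torsion_conjH1_pow_eq (n k : ℕ) :
    {s : W.selmerInfty κ | W.conjH1 p κ.kerSubgroup (γ ^ p ^ n) (s : W.subgroupH1 p κ.kerSubgroup) = s ∧ p ^ k • s = 0}.Finite := by
  set D := W.selmerDualData κ hγ
  haveI : Module.Finite (IwasawaAlgebra p) D.X := D.module_finite_holds hγ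
  obtain ⟨d, x, hx⟩ := Module.Finite.exists_fin (R := IwasawaAlgebra p) (M := D.X)
  exact (finite_setOf_selmerInfty_pow_torsion_conjH1_pow_eq_of_span W κ hγ x hx n k).1

include hγ in
/-- **The `k = 1` shape of the line's stubs** (K2_res / P_res, and `hfin` of `…SelmerTorsionOverComap.natCard_selmerTorsionOver_layer_le`):
`{s ∈ Sel_{p^∞}(E/K_∞) : p • s = 0 ∧ conj_{γ^{pⁿ}} s = s}` is finite for every `n`, so the `Nat.card` bounds of those stubs are honest
cardinalities. [cite: GreenbergLNM1716, §1 p. 60 (after Conj. 1.3)] -/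
theorem finite_setOf_selmerInfty_pTorsion_conjH1_pow_eq (n : ℕ) :
    Set.Finite {s : W.selmerInfty κ |
      p • s = 0 ∧ W.conjH1 p κ.kerSubgroup (γ ^ p ^ n) (s : W.subgroupH1 p κ.kerSubgroup) = s} := by
  have h := finite_setOf_selmerInfty_pow_torsion_conjH1_pow_eq W κ hγ n 1
  rw [pow_one] at h
  exact h.subset fun s hs ↦ ⟨hs.2, hs.1⟩

/-- The same with the generator as a `Fact` instance (the binder shape of the crux `TwinAlgMuZeroAtThree`). [cite: GreenbergLNM1716, §1 p. 60] -/
theorem finite_setOf_selmerInfty_pTorsion_conjH1_pow_eq' (γ : Field.absoluteGaloisGroup K) [hγ : Fact (κ.IsTopGenerator γ)]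
    (n : ℕ) :
    Set.Finite {s : W.selmerInfty κ |
      p • s = 0 ∧ W.conjH1 p κ.kerSubgroup (γ ^ p ^ n) (s : W.subgroupH1 p κ.kerSubgroup) = s} :=
  finite_setOf_selmerInfty_pTorsion_conjH1_pow_eq W κ hγ.out n

end Summit.BirchSwinnertonDyer.BirchSwinnertonDyer.Theorems.UniversalToricDescentSelmerInftyLayerTorsionFinite

end
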